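import Summits.MatrixMultiplication.MatrixMultiplication.Theorems.ObstructionDescentEvaluationSpans
import Summits.MatrixMultiplication.MatrixMultiplication.Theorems.ObstructionDescentCoreWindow
import Summits.MatrixMultiplication.MatrixMultiplication.Theorems.ObstructionCalculusPointwiseSaturation
import Literature.Computability.AlgebraicComplexity.SmallFormatRankLaderman

set_option linter.dupNamespace false
set_option autoImplicit false

/-!
# Obstruction descent — `OccurrenceLifts` lives on the DIP window `{(n,m) : occurrence blind, m < bR(⟨n,n,n⟩)}`
(decomp-mm · lens 3 · gen 31, second kernel; def-free)

Companion of `ObstructionDescentEvaluationSpans`.  There the cell `(n,m)` of the second binder `L = OccurrenceLifts` of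
`route-MatrixMultiplication-ObstructionDescent` — "occurrence inclusion at `(n,m)` ⟹ multiplicity domination at `(n,m)`" for the
pair (`pad_m⟨n,n,n⟩`, `⟨m⟩`) — was decided OUTSIDE the torsion window.  This file lifts that to the FAMILY level and records the
next instrument row.

* §1  A strict multiplicity drop `coMult pad_m⟨n,n,n⟩ Λ d < coMult ⟨m⟩ Λ d` can only happen below the border rank
  (`lt_algBorderRank_of_coMult_lt`), and `¬P_M` is exactly the persistence of such drops at super-quadratic formats
  (`not_noMultiplicityObstruction_iff`).
* §2  THE WINDOW THEOREM.  `L` fails iff `P_O` holds and, for some `τ > 2`, cofinally in `n`, there is a cell `(n,m)` with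
  `n^τ ≤ m < bR(⟨n,n,n⟩)` that is occurrence-BLIND (`S(⟨n,n,n⟩) ⊆ S(⟨m⟩)`) yet carries a strict multiplicity drop
  (`not_occurrenceLifts_iff_window`) — the Dörfler–Ikenmeyer–Panova phenomenon ("multiplicities see what occurrences do not")
  for the pair (matrix multiplication, unit tensor), required at formats polynomially above `n²` and infinitely often.
  Equivalently `L ⟺ (P_O → cell-wise lifting on the window)` (`occurrenceLifts_iff_window`): to prove `L` it suffices to treat the
  blind cells strictly below the border rank; if border rank is eventually quadratic the window is empty
  (`occurrenceLifts_of_algBorderRank_eventually`; over `ℂ` that hypothesis is summit-strength by Bini — a NEC certificate only).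
* §3  INSTRUMENT ROWS.  Row `n = 3`: the cells `m ∈ {9, 10}` of `P_O` and `P_M` fail (Bürgisser–Ikenmeyer's `λ₃ ⊢ 18`), the cells
  `m ≥ 23` of `P_M` hold (Laderman's algorithm, `R(⟨3,3,3⟩) ≤ 23`), so the row of `L` is decided except on `11 ≤ m ≤ 22`
  (`cellL_three`); row `n = 2`: the single open cell `(2,6)` of `L` fails iff it is a DIP cell (`not_cellL_two_six_iff`;
  `bR(⟨2,2,2⟩) = 7 > 6` is Landsberg's theorem, `Literature…algBorderRank_matMulTensor_two`, so `(2,6)` IS in the window's format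
  range and the question is exactly the route's test `T_O1` plus one multiplicity comparison).

No proposition is defined; no `def`; sorry-free; standard axioms.  Nothing here proves `ω = 2` or closes an item.
[cite: BurgisserIkenmeyer2011, §3.1, Lemma 6.1] [cite: DorflerIkenmeyerPanova2020, Thm. 2.3] [cite: Laderman1976, p. 126]
[cite: BurgisserClausenShokrollahi1997, Thm. (20.3)] [cite: Strassen1969]
-/

noncomputable section

open scoped BigOperators

namespace Summit.MatrixMultiplication.MatrixMultiplication.Theorems.ObstructionCalculus

open Literature.Computability.AlgebraicComplexity (actTensor matMulTensor unitTensor tensorRank algBorderRank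
  algBorderRank_le_tensorRank tensorRank_matMulTensor_two_le_seven tensorRank_matMulTensor_three_le_twentyThree)
open Summit.MatrixMultiplication.MatrixMultiplication.Theses.ObstructionDescent
  (NoOccurrenceObstruction NoMultiplicityObstruction OccurrenceLifts)
open Summit.MatrixMultiplication.MatrixMultiplication.Theorems.ObstructionDescentInformationAxis
  (noOccurrenceObstruction_iff noMultiplicityObstruction_iff coMult_le_of_rank_le)
open Summit.MatrixMultiplication.MatrixMultiplication.Theorems.ObstructionDescentCoreWindow (occurrenceLifts_iff_core)

variable {m : ℕ}

/-! ## §1  Drops live below the border rank; `¬P_M` is the persistence of drops -/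

/-- **A strict multiplicity drop forces `m < bR(⟨n,n,n⟩)`**: above the border rank multiplicity domination holds outright
(`coMult_le_of_algBorderRank_le`). [cite: BurgisserClausenShokrollahi1997, Thm. (20.3)] [cite: BurgisserIkenmeyer2011, §3.1] -/
theorem lt_algBorderRank_of_coMult_lt {n : ℕ} (h : n * n ≤ m) {Λ : Fin 3 → Fin m → ℕ} {d : ℕ}
    (hlt : coMult (padMM ℂ n m h) Λ d < coMult (unitTensor ℂ m) Λ d) : m < algBorderRank (matMulTensor ℂ n n n) := by
  by_contra hbr
  exact absurd (coMult_le_of_algBorderRank_le h (not_lt.1 hbr) Λ d) (not_le.2 hlt)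

/-- A strict multiplicity drop forces `m < R(⟨n,n,n⟩)` as well (`bR ≤ R`). [bookkeeping] -/
theorem lt_tensorRank_of_coMult_lt {n : ℕ} (h : n * n ≤ m) {Λ : Fin 3 → Fin m → ℕ} {d : ℕ}
    (hlt : coMult (padMM ℂ n m h) Λ d < coMult (unitTensor ℂ m) Λ d) : m < tensorRank (matMulTensor ℂ n n n) :=
  (lt_algBorderRank_of_coMult_lt h hlt).trans_le (algBorderRank_le_tensorRank _)

/-- **`¬P_M` unfolded**: a multiplicity obstruction above the quadratic scale is a `τ > 2` together with, cofinally in `n`,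
a cell `(n,m)`, `m ≥ n^τ`, carrying a strict drop `coMult pad_m⟨n,n,n⟩ Λ d < coMult ⟨m⟩ Λ d`. [cite: BurgisserIkenmeyer2011, §3.1] -/
theorem not_noMultiplicityObstruction_iff : ¬ NoMultiplicityObstruction ↔
    ∃ τ : ℝ, 2 < τ ∧ ∀ n₀ : ℕ, ∃ n m : ℕ, n₀ ≤ n ∧ ∃ h : n * n ≤ m, (n : ℝ) ^ τ ≤ (m : ℝ) ∧
      ∃ (Λ : Fin 3 → Fin m → ℕ) (d : ℕ), coMult (padMM ℂ n m h) Λ d < coMult (unitTensor ℂ m) Λ d := by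
  rw [noMultiplicityObstruction_iff]
  push Not
  rfl

/-- Every cell of a multiplicity obstruction lies strictly below the border rank: `¬P_M` forces `bR(⟨n,n,n⟩) > n^τ` for some
`τ > 2` and infinitely many `n`. [cite: BurgisserIkenmeyer2011, §3.1] [cite: BurgisserClausenShokrollahi1997, Thm. (20.3)] -/
theorem exists_algBorderRank_gt_of_not_noMultiplicityObstruction (hM : ¬ NoMultiplicityObstruction) :
    ∃ τ : ℝ, 2 < τ ∧ ∀ n₀ : ℕ, ∃ n : ℕ, n₀ ≤ n ∧ (n : ℝ) ^ τ < (algBorderRank (matMulTensor ℂ n n n) : ℝ) := by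
  obtain ⟨τ, hτ, hcof⟩ := not_noMultiplicityObstruction_iff.1 hM
  refine ⟨τ, hτ, fun n₀ => ?_⟩
  obtain ⟨n, m, hn, h, hτm, Λ, d, hlt⟩ := hcof n₀
  refine ⟨n, hn, hτm.trans_lt ?_⟩
  exact_mod_cast lt_algBorderRank_of_coMult_lt h hlt

/-! ## §2  The window theorem -/

/-- **Multiplicity-free types lift automatically.**  If `dim HWV_{Λ,d} ≤ 1` then occurrence inclusion at `(Λ,d)` already gives
multiplicity domination at `(Λ,d)`: a DIP type needs `dim HWV_{Λ,d} ≥ 2`, i.e. Kronecker-type multiplicity at least two in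
`ℂ[(ℂ^m)^{⊗3}]_d` (all three levels of the dial coincide on a line). [cite: BurgisserIkenmeyer2011, §3.1]
[cite: DorflerIkenmeyerPanova2020, Thm. 2.3] -/
theorem coMult_le_coMult_of_finrank_hwvSpace_le_one {u s : Tensor ℂ m} {Λ : Fin 3 → Fin m → ℕ} {d : ℕ}
    (hdim : Module.finrank ℂ (hwvSpace Λ d) ≤ 1)
    (hocc : hwvSpace Λ d ≤ orbitVanishing u → hwvSpace Λ d ≤ orbitVanishing s) : coMult u Λ d ≤ coMult s Λ d := by
  by_cases hu : hwvSpace Λ d ≤ orbitVanishing u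
  · rw [coMult_eq_finrank_of_le (hocc hu)]
    exact coMult_le_finrank_hwvSpace u Λ d
  · have h1 : ¬ Module.finrank ℂ (hwvSpace Λ d) ≤ coMult u Λ d := fun hle => hu (le_orbitVanishing_of_finrank_le_coMult hle)
    omega

/-- Contrapositive: at an occurrence-blind pair, a strict drop sits on a type of multiplicity `≥ 2`. [bookkeeping] -/
theorem two_le_finrank_hwvSpace_of_coMult_lt {u s : Tensor ℂ m} {Λ : Fin 3 → Fin m → ℕ} {d : ℕ}
    (hocc : hwvSpace Λ d ≤ orbitVanishing u → hwvSpace Λ d ≤ orbitVanishing s) (hlt : coMult s Λ d < coMult u Λ d) :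
    2 ≤ Module.finrank ℂ (hwvSpace Λ d) := by
  by_contra hdim
  exact absurd (coMult_le_coMult_of_finrank_hwvSpace_le_one (by omega) hocc) (not_le.2 hlt)

/-- **Where `L` fails, exactly.**  `¬ OccurrenceLifts` iff `P_O` holds AND for some `τ > 2`, cofinally in `n`, some cell `(n,m)`
with `n^τ ≤ m < bR(⟨n,n,n⟩)` is occurrence-blind (every type vanishing on `GL³·⟨m⟩` vanishes on `GL³·pad_m⟨n,n,n⟩`) and carries
a strict multiplicity drop, necessarily on a type of multiplicity `dim HWV_{Λ,d} ≥ 2`. [cite: DorflerIkenmeyerPanova2020, Thm. 2.3] [cite: BurgisserIkenmeyer2011, §3.1] -/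
theorem not_occurrenceLifts_iff_window : ¬ OccurrenceLifts ↔
    NoOccurrenceObstruction ∧
    ∃ τ : ℝ, 2 < τ ∧ ∀ n₀ : ℕ, ∃ n m : ℕ, n₀ ≤ n ∧ ∃ h : n * n ≤ m, (n : ℝ) ^ τ ≤ (m : ℝ) ∧
      m < algBorderRank (matMulTensor ℂ n n n) ∧
      (∀ (Λ : Fin 3 → Fin m → ℕ) (d : ℕ), hwvSpace Λ d ≤ orbitVanishing (unitTensor ℂ m) →
          hwvSpace Λ d ≤ orbitVanishing (padMM ℂ n m h)) ∧
      ∃ (Λ : Fin 3 → Fin m → ℕ) (d : ℕ), 2 ≤ Module.finrank ℂ (hwvSpace Λ d) ∧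
        coMult (padMM ℂ n m h) Λ d < coMult (unitTensor ℂ m) Λ d := by
  unfold OccurrenceLifts
  rw [Classical.not_imp]
  constructor
  · rintro ⟨hO, hM⟩
    obtain ⟨τ, hτ, hcof⟩ := not_noMultiplicityObstruction_iff.1 hM
    obtain ⟨n₁, hn₁⟩ := noOccurrenceObstruction_iff.1 hO τ hτ
    refine ⟨hO, τ, hτ, fun n₀ => ?_⟩
    obtain ⟨n, m, hn, h, hτm, Λ, d, hlt⟩ := hcof (max n₀ n₁)
    have hcell := hn₁ n m (le_trans (le_max_right _ _) hn) h hτm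
    exact ⟨n, m, le_trans (le_max_left _ _) hn, h, hτm, lt_algBorderRank_of_coMult_lt h hlt, hcell, Λ, d,
      two_le_finrank_hwvSpace_of_coMult_lt (hcell Λ d) hlt, hlt⟩
  · rintro ⟨hO, τ, hτ, hcof⟩
    refine ⟨hO, not_noMultiplicityObstruction_iff.2 ⟨τ, hτ, fun n₀ => ?_⟩⟩
    obtain ⟨n, m, hn, h, hτm, -, -, Λ, d, -, hlt⟩ := hcof n₀
    exact ⟨n, m, hn, h, hτm, Λ, d, hlt⟩

/-- **`L` lives on the window.**  `OccurrenceLifts` iff: granted `P_O`, for every `τ > 2`, eventually in `n`, at every cell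
`(n,m)` with `n^τ ≤ m < bR(⟨n,n,n⟩)` that is occurrence-blind, multiplicity domination holds on every type of multiplicity
`dim HWV_{Λ,d} ≥ 2`.  (Cells with `m ≥ bR` lift for free, `cellL_of_algBorderRank_le`; cells that are not blind lift vacuously;
multiplicity-free types lift by `coMult_le_coMult_of_finrank_hwvSpace_le_one`.) [cite: BurgisserIkenmeyer2011, §3.1]
[cite: BurgisserClausenShokrollahi1997, Thm. (20.3)] -/
theorem occurrenceLifts_iff_window : OccurrenceLifts ↔ (NoOccurrenceObstruction →
    ∀ τ : ℝ, 2 < τ → ∃ n₀ : ℕ, ∀ n m : ℕ, n₀ ≤ n → ∀ h : n * n ≤ m, (n : ℝ) ^ τ ≤ (m : ℝ) →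
      m < algBorderRank (matMulTensor ℂ n n n) →
      (∀ (Λ : Fin 3 → Fin m → ℕ) (d : ℕ), hwvSpace Λ d ≤ orbitVanishing (unitTensor ℂ m) →
          hwvSpace Λ d ≤ orbitVanishing (padMM ℂ n m h)) →
        ∀ (Λ : Fin 3 → Fin m → ℕ) (d : ℕ), 2 ≤ Module.finrank ℂ (hwvSpace Λ d) →
          coMult (unitTensor ℂ m) Λ d ≤ coMult (padMM ℂ n m h) Λ d) := by
  constructor
  · intro hL hO τ hτ
    obtain ⟨n₀, hn₀⟩ := noMultiplicityObstruction_iff.1 (hL hO) τ hτ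
    exact ⟨n₀, fun n m hn h hτm _ _ Λ d _ => hn₀ n m hn h hτm Λ d⟩
  · intro hW hO
    refine noMultiplicityObstruction_iff.2 fun τ hτ => ?_
    obtain ⟨n₁, hn₁⟩ := noOccurrenceObstruction_iff.1 hO τ hτ
    obtain ⟨n₂, hn₂⟩ := hW hO τ hτ
    refine ⟨max n₁ n₂, fun n m hn h hτm Λ d => ?_⟩
    rcases Nat.lt_or_ge m (algBorderRank (matMulTensor ℂ n n n)) with hlt | hge
    · have hcell := hn₁ n m (le_trans (le_max_left _ _) hn) h hτm
      rcases Nat.lt_or_ge (Module.finrank ℂ (hwvSpace Λ d)) 2 with hdim | hdim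
      · exact coMult_le_coMult_of_finrank_hwvSpace_le_one (by omega) (hcell Λ d)
      · exact hn₂ n m (le_trans (le_max_right _ _) hn) h hτm hlt hcell Λ d hdim
    · exact coMult_le_of_algBorderRank_le h hge Λ d

/-- **Empty window.**  If the border rank of `⟨n,n,n⟩` is eventually below `n^τ` for every `τ > 2` then the window is empty and
`L` holds (indeed `P_M` holds outright, `noMultiplicityObstruction_of_evalSpan_family`).  Over `ℂ` the hypothesis is `ω = 2` by
Bini's theorem, so this is a necessity certificate, not progress. [cite: BurgisserClausenShokrollahi1997, Thm. (20.3)] -/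
theorem occurrenceLifts_of_algBorderRank_eventually
    (hbr : ∀ τ : ℝ, 2 < τ → ∃ n₀ : ℕ, ∀ n : ℕ, n₀ ≤ n → (algBorderRank (matMulTensor ℂ n n n) : ℝ) ≤ (n : ℝ) ^ τ) :
    OccurrenceLifts := by
  refine occurrenceLifts_iff_window.2 fun _ τ hτ => ?_
  obtain ⟨n₀, hn₀⟩ := hbr τ hτ
  refine ⟨n₀, fun n m hn h hτm hlt => ?_⟩
  exfalso
  have h1 : (algBorderRank (matMulTensor ℂ n n n) : ℝ) ≤ (m : ℝ) := (hn₀ n hn).trans hτm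
  exact absurd (by exact_mod_cast h1 : algBorderRank (matMulTensor ℂ n n n) ≤ m) (not_le.2 hlt)

/-- **The two windows compose** (with the gen-2x core window `occurrenceLifts_iff_core`): `L` iff, granted `P_O`, for every
`2 < τ < 4`, eventually in `n`, at every occurrence-blind cell `n^τ ≤ m < bR(⟨n,n,n⟩)` and every type `Λ ⊢₃ d` in the CORE — `d > m`,
each `Λ_s` with at most `n²` rows, pairwise products of the row counts exceeding `m` — of multiplicity `dim HWV_{Λ,d} ≥ 2`, multiplicity
domination holds.  This is the instrument specification of item 29042. [cite: BurgisserIkenmeyer2011, §3.1, Thm. 5.5]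
[cite: BurgisserClausenShokrollahi1997, Thm. (20.3)] -/
theorem occurrenceLifts_iff_core_window : OccurrenceLifts ↔ (NoOccurrenceObstruction →
    ∀ τ : ℝ, 2 < τ → τ < 4 → ∃ n₀ : ℕ, ∀ n m : ℕ, n₀ ≤ n → ∀ h : n * n ≤ m, (n : ℝ) ^ τ ≤ (m : ℝ) →
      m < algBorderRank (matMulTensor ℂ n n n) →
      (∀ (Λ : Fin 3 → Fin m → ℕ) (d : ℕ), hwvSpace Λ d ≤ orbitVanishing (unitTensor ℂ m) →
          hwvSpace Λ d ≤ orbitVanishing (padMM ℂ n m h)) →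
      ∀ (Λ : Fin 3 → Fin m → ℕ) (d : ℕ), m < d → (∀ s, (Finset.univ.filter fun a => Λ s a ≠ 0).card ≤ n * n) →
        m < (Finset.univ.filter fun a => Λ 0 a ≠ 0).card * (Finset.univ.filter fun a => Λ 1 a ≠ 0).card →
        m < (Finset.univ.filter fun a => Λ 0 a ≠ 0).card * (Finset.univ.filter fun a => Λ 2 a ≠ 0).card →
        m < (Finset.univ.filter fun a => Λ 1 a ≠ 0).card * (Finset.univ.filter fun a => Λ 2 a ≠ 0).card →
        2 ≤ Module.finrank ℂ (hwvSpace Λ d) →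
          coMult (unitTensor ℂ m) Λ d ≤ coMult (padMM ℂ n m h) Λ d) := by
  constructor
  · intro hL hO τ hτ _
    obtain ⟨n₀, hn₀⟩ := noMultiplicityObstruction_iff.1 (hL hO) τ hτ
    exact ⟨n₀, fun n m hn h hτm _ _ Λ d _ _ _ _ _ _ => hn₀ n m hn h hτm Λ d⟩
  · intro hW
    refine occurrenceLifts_iff_core.2 fun hO τ hτ hτ4 => ?_
    obtain ⟨n₁, hn₁⟩ := noOccurrenceObstruction_iff.1 hO τ hτ
    obtain ⟨n₂, hn₂⟩ := hW hO τ hτ hτ4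
    refine ⟨max n₁ n₂, fun n m hn h hτm Λ d hd hfew h01 h02 h12 => ?_⟩
    rcases Nat.lt_or_ge m (algBorderRank (matMulTensor ℂ n n n)) with hlt | hge
    · have hcell := hn₁ n m (le_trans (le_max_left _ _) hn) h hτm
      rcases Nat.lt_or_ge (Module.finrank ℂ (hwvSpace Λ d)) 2 with hdim | hdim
      · exact coMult_le_coMult_of_finrank_hwvSpace_le_one (by omega) (hcell Λ d)
      · exact hn₂ n m (le_trans (le_max_right _ _) hn) h hτm hlt hcell Λ d hd hfew h01 h02 h12 hdim
    · exact coMult_le_of_algBorderRank_le h hge Λ d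

/-- **A window cell is a DIP cell for the pair (`⟨n,n,n⟩`, `⟨m⟩`).**  If the cell `(n,m)` of `L` fails then some type `Λ ⊢ d`
OCCURS for both `pad_m⟨n,n,n⟩` and `⟨m⟩` (its weight vectors do not all vanish on either orbit), has multiplicity `dim HWV_{Λ,d} ≥ 2`,
and its co-multiplicity for `pad_m⟨n,n,n⟩` is strictly smaller: occurrence cannot separate, multiplicity does. [cite: DorflerIkenmeyerPanova2020, Thm. 2.3] -/
theorem exists_dip_type_of_not_cellL {n : ℕ} (h : n * n ≤ m)
    (hL : ¬ ((∀ (Λ : Fin 3 → Fin m → ℕ) (d : ℕ), hwvSpace Λ d ≤ orbitVanishing (unitTensor ℂ m) →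
        hwvSpace Λ d ≤ orbitVanishing (padMM ℂ n m h)) →
      ∀ (Λ : Fin 3 → Fin m → ℕ) (d : ℕ), coMult (unitTensor ℂ m) Λ d ≤ coMult (padMM ℂ n m h) Λ d)) :
    ∃ (Λ : Fin 3 → Fin m → ℕ) (d : ℕ), ¬ hwvSpace Λ d ≤ orbitVanishing (padMM ℂ n m h) ∧
      ¬ hwvSpace Λ d ≤ orbitVanishing (unitTensor ℂ m) ∧ 2 ≤ Module.finrank ℂ (hwvSpace Λ d) ∧
      coMult (padMM ℂ n m h) Λ d < coMult (unitTensor ℂ m) Λ d := by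
  obtain ⟨hO, -, Λ, d, hlt⟩ := cellO_and_lt_algBorderRank_of_not_cellL h hL
  have hpad : ¬ hwvSpace Λ d ≤ orbitVanishing (padMM ℂ n m h) := by
    intro hle
    have h1 := coMult_eq_finrank_of_le hle
    have h2 := coMult_le_finrank_hwvSpace (unitTensor ℂ m) Λ d
    omega
  exact ⟨Λ, d, hpad, fun hu => hpad (hO Λ d hu), two_le_finrank_hwvSpace_of_coMult_lt (hO Λ d) hlt, hlt⟩

/-! ## §3  Instrument rows -/

/-- **Row `n = 3`, `P_O`**: the cells `m ∈ {9, 10}` fail (`λ₃ = ((11,1⁷),(2⁹),(2⁹)) ⊢ 18` obstructs).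
[cite: BurgisserIkenmeyer2011, Lemma 6.1] -/
theorem not_cellO_three_of_le_ten (h : 3 * 3 ≤ m) (hm : m ≤ 10) :
    ¬ (∀ (Λ : Fin 3 → Fin m → ℕ) (d : ℕ), hwvSpace Λ d ≤ orbitVanishing (unitTensor ℂ m) →
        hwvSpace Λ d ≤ orbitVanishing (padMM ℂ 3 m h)) :=
  not_cellO_of_le_sq_add_one 3 (by norm_num) h (by omega)

/-- **Row `n = 3`, `P_M`**: the cells `m ∈ {9, 10}` fail. [cite: BurgisserIkenmeyer2011, Lemma 6.1] -/
theorem not_cellM_three_of_le_ten (h : 3 * 3 ≤ m) (hm : m ≤ 10) :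
    ¬ (∀ (Λ : Fin 3 → Fin m → ℕ) (d : ℕ), coMult (unitTensor ℂ m) Λ d ≤ coMult (padMM ℂ 3 m h) Λ d) :=
  not_cellM_of_le_sq_add_one 3 (by norm_num) h (by omega)

/-- **Row `n = 3`, `P_M`**: the cells `m ≥ 23` hold — Laderman's 23-multiplication algorithm puts `pad_m⟨3,3,3⟩` into
`Mat_m³·⟨m⟩`. [cite: Laderman1976, p. 126] [cite: BurgisserIkenmeyer2011, §3.1] -/
theorem cellM_three_of_twentyThree_le (h : 3 * 3 ≤ m) (hm : 23 ≤ m) :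
    ∀ (Λ : Fin 3 → Fin m → ℕ) (d : ℕ), coMult (unitTensor ℂ m) Λ d ≤ coMult (padMM ℂ 3 m h) Λ d :=
  fun Λ d => coMult_le_of_rank_le h ((tensorRank_matMulTensor_three_le_twentyThree ℂ).trans hm) Λ d

/-- **Row `n = 3` of `L` is decided off `11 ≤ m ≤ 22`**: vacuously for `m ∈ {9,10}`, genuinely for `m ≥ 23`.  The twelve open
cells `(3,11), …, (3,22)` contain the border-rank window `m < bR(⟨3,3,3⟩)`, `17 ≤ bR(⟨3,3,3⟩) ≤ 20` in print (Conner–Harper–Landsberg;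
Smirnov), not used here.
[cite: BurgisserIkenmeyer2011, Lemma 6.1] [cite: Laderman1976, p. 126] -/
theorem cellL_three (h : 3 * 3 ≤ m) (hm : m ≤ 10 ∨ 23 ≤ m) :
    (∀ (Λ : Fin 3 → Fin m → ℕ) (d : ℕ), hwvSpace Λ d ≤ orbitVanishing (unitTensor ℂ m) →
        hwvSpace Λ d ≤ orbitVanishing (padMM ℂ 3 m h)) →
      ∀ (Λ : Fin 3 → Fin m → ℕ) (d : ℕ), coMult (unitTensor ℂ m) Λ d ≤ coMult (padMM ℂ 3 m h) Λ d := by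
  rcases hm with hm | hm
  · exact fun hO => absurd hO (not_cellO_three_of_le_ten h hm)
  · exact fun _ => cellM_three_of_twentyThree_le h hm

/-- **Row `n`, general template**: the cell `(n,m)` of `L` is decided whenever `m ≤ n² + 1` or `R(⟨n,n,n⟩) ≤ m` — every new
upper bound on `R(⟨n,n,n⟩)` (or on `bR`, `cellL_of_algBorderRank_le`) shrinks the undecided window from above.
[cite: BurgisserIkenmeyer2011, Lemma 6.1, §3.1] -/
theorem cellL_of_le_sq_add_one_or_rank_le (n : ℕ) (hn : 2 ≤ n) (h : n * n ≤ m)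
    (hm : m ≤ n ^ 2 + 1 ∨ tensorRank (matMulTensor ℂ n n n) ≤ m) :
    (∀ (Λ : Fin 3 → Fin m → ℕ) (d : ℕ), hwvSpace Λ d ≤ orbitVanishing (unitTensor ℂ m) →
        hwvSpace Λ d ≤ orbitVanishing (padMM ℂ n m h)) →
      ∀ (Λ : Fin 3 → Fin m → ℕ) (d : ℕ), coMult (unitTensor ℂ m) Λ d ≤ coMult (padMM ℂ n m h) Λ d := by
  rcases hm with hm | hm
  · exact cellL_of_le_sq_add_one n hn h hm
  · exact fun _ Λ d => coMult_le_of_rank_le h hm Λ d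

/-- **The open cell `(2,6)` of `L` fails iff it is a DIP cell**: occurrence-blind (`S(⟨2,2,2⟩) ⊆ S(⟨6⟩)`, the route's test `T_O1`)
with a strict multiplicity drop at some type (necessarily of multiplicity `≥ 2`, `two_le_finrank_hwvSpace_of_coMult_lt`).  (`6 < bR(⟨2,2,2⟩) = 7` —
Landsberg — so `(2,6)` lies in the window's format range; Bürgisser–Ikenmeyer's `λ₂ ⊢ 8` OCCURS for `⟨6⟩`, and no polynomial of degree `< 19`
vanishes on `σ₆(4×4×4)`, so blindness at `(2,6)` is decided in degrees `≥ 19` only.) [cite: DorflerIkenmeyerPanova2020, Thm. 2.3]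
[cite: BurgisserIkenmeyer2011, §3.1, Thm. 4.4] [cite: HauensteinIkenmeyerLandsberg2013, §1 (no equations of degree < 19 for σ₆)] -/
theorem not_cellL_two_six_iff (h : 2 * 2 ≤ 6) :
    ¬ ((∀ (Λ : Fin 3 → Fin 6 → ℕ) (d : ℕ), hwvSpace Λ d ≤ orbitVanishing (unitTensor ℂ 6) →
        hwvSpace Λ d ≤ orbitVanishing (padMM ℂ 2 6 h)) →
      ∀ (Λ : Fin 3 → Fin 6 → ℕ) (d : ℕ), coMult (unitTensor ℂ 6) Λ d ≤ coMult (padMM ℂ 2 6 h) Λ d) ↔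
    (∀ (Λ : Fin 3 → Fin 6 → ℕ) (d : ℕ), hwvSpace Λ d ≤ orbitVanishing (unitTensor ℂ 6) →
        hwvSpace Λ d ≤ orbitVanishing (padMM ℂ 2 6 h)) ∧
      ∃ (Λ : Fin 3 → Fin 6 → ℕ) (d : ℕ), coMult (padMM ℂ 2 6 h) Λ d < coMult (unitTensor ℂ 6) Λ d := by
  rw [Classical.not_imp]
  push Not
  rfl

/-- **The `n = 2` row of `L`, complete statement**: `L` holds at every cell `(2,m)`, `m ≥ 4`, unless `m = 6` and `(2,6)` is a
DIP cell. [cite: BurgisserIkenmeyer2011, Lemma 6.1] [cite: Strassen1969] [cite: DorflerIkenmeyerPanova2020, Thm. 2.3] -/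
theorem cellL_two_or (h : 2 * 2 ≤ m) :
    ((∀ (Λ : Fin 3 → Fin m → ℕ) (d : ℕ), hwvSpace Λ d ≤ orbitVanishing (unitTensor ℂ m) →
        hwvSpace Λ d ≤ orbitVanishing (padMM ℂ 2 m h)) →
      ∀ (Λ : Fin 3 → Fin m → ℕ) (d : ℕ), coMult (unitTensor ℂ m) Λ d ≤ coMult (padMM ℂ 2 m h) Λ d) ∨
    (m = 6 ∧ ∃ (Λ : Fin 3 → Fin m → ℕ) (d : ℕ), coMult (padMM ℂ 2 m h) Λ d < coMult (unitTensor ℂ m) Λ d) := by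
  by_cases hm6 : m = 6
  · by_cases hL : ((∀ (Λ : Fin 3 → Fin m → ℕ) (d : ℕ), hwvSpace Λ d ≤ orbitVanishing (unitTensor ℂ m) →
        hwvSpace Λ d ≤ orbitVanishing (padMM ℂ 2 m h)) →
      ∀ (Λ : Fin 3 → Fin m → ℕ) (d : ℕ), coMult (unitTensor ℂ m) Λ d ≤ coMult (padMM ℂ 2 m h) Λ d)
    · exact Or.inl hL
    · obtain ⟨-, -, Λ, d, hlt⟩ := cellO_and_lt_algBorderRank_of_not_cellL h hL
      exact Or.inr ⟨hm6, Λ, d, hlt⟩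
  · exact Or.inl (cellL_two h hm6)

end Summit.MatrixMultiplication.MatrixMultiplication.Theorems.ObstructionCalculus

end
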